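import Mathlib.ModelTheory.Complexity
import Mathlib.ModelTheory.Equivalence
import Mathlib.ModelTheory.Definability
import Mathlib.ModelTheory.Satisfiability
import Mathlib.ModelTheory.Order
import Mathlib.Order.BooleanSubalgebra
import HarnessLib

-- provenance: harness21/H21/H21/Prelude/TranscendEllArithS/ModelTheoryPreds.lean @ 76e3a6b (interim HEAD d8f2665); M5 mechanical rewrite
/-!
# Model-theoretic predicates: quantifier elimination, model completeness, o-minimality

Trunk `TranscendEllArithS`, concept C7 (notions `o_minimal_structure`, `model_complete_qe`).

This file provides the three basic model-theoretic predicates consumed by the statements on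
real closed fields, the real exponential field and o-minimal geometry (Tarski, Wilkie,
Pillay–Steinhorn):

* `FirstOrder.Language.Theory.HasQE T`: the theory `T` admits quantifier elimination — every
  formula in finitely many free variables is `T`-equivalent to a quantifier-free one
  (Marker, *Model Theory: An Introduction* (2002), Def. 3.1.1).
* `FirstOrder.Language.Theory.IsModelComplete T`: every embedding between models of `T` is
  elementary (Marker 2002, Def. 3.1.10; A. Robinson 1956).
* `Literature.IsFiniteUnionOfIntervals s`: a subset of a linear order lies in the Boolean algebra
  generated by the open rays `Set.Iio a`, `Set.Ioi a`; equivalently it is a finite union of points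
  and open intervals (with endpoints in `M ∪ {±∞}`) (van den Dries, *Tame topology and o-minimal
  structures* (1998), Ch. 1, (1.4) and (3.2)).
* `FirstOrder.Language.IsOMinimal L M`: every subset of `M` definable with parameters is a finite
  union of points and intervals (Pillay–Steinhorn, *Definable sets in ordered structures I*,
  Trans. AMS 295 (1986), Def. 1.1, p. 566, for an arbitrary linearly ordered structure; van den
  Dries 1998, Ch. 1, (3.2) and (5.7), who restricts to dense orders without endpoints).
* `FirstOrder.Language.Theory.IsOMinimal T`: every (ordered) model of `T` is o-minimal
  ("strongly O-minimal theory" in Pillay–Steinhorn 1986, Def. 1.1).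

These are *definitions* (predicates on a structure, resp. a theory), not claims: o-minimality fails
e.g. for Presburger arithmetic on `ℤ` (see `OMinimalExamples.lean` in this directory), so there is
no `IsOMinimal_holds`; o-minimality of a specific structure (Tarski, Wilkie) is a named fact in
`RealExpField.lean`. The predicates carry their parameters as explicit binders in the `def`
headers (rather than through `variable`) so that textual scans distinguish them from closed named
facts `def X : Prop`.

## Mathlib search

Mathlib (this pin) has `BoundedFormula.IsQF`, `IsExistential`, `IsUniversal`, `Theory.Iff`
(`φ ⇔[T] ψ`), `Theory.IsComplete`, `Set.Definable₁`, `Language.OrderedStructure`, but no notion of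
quantifier elimination for a theory, model completeness, or o-minimality
(`rg -i 'OMinimal|HasQE|ModelComplete|QuantifierElim' Mathlib/ModelTheory` is empty). We therefore
define them here.

## Design choices

* `HasQE`, `IsModelComplete`, `Theory.IsOMinimal` are deliberate dot-notation extensions in the
  Mathlib namespaces `FirstOrder.Language.Theory` / `FirstOrder.Language` (so that one writes
  `T.HasQE`, `L.IsOMinimal M`), as sanctioned by the trunk outline. The order-theoretic helper
  `IsFiniteUnionOfIntervals` lives in `namespace Literature`.
* `IsModelComplete` is phrased semantically over bundled models
  `Theory.ModelType.{u, v, max u v} T`, with the same universe convention as Mathlib's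
  `Theory.IsComplete` / `Theory.models_sentence_iff`.
* `HasQE` quantifies over formulas with free variables `Fin n`; this is equivalent to the version
  with an arbitrary finite variable type, and matches `Theory.Iff`, whose universe for `Fin n` is
  `max u v`.
* `Theory.IsOMinimal` takes the order on each model as explicit instance binders
  `[LinearOrder M] [L.OrderedStructure M]`: since `OrderedStructure` pins `≤` to the interpretation
  of `leSymb`, the linear order is determined by the structure, so this is the usual notion.
-/

universe u v w

open Set
open scoped FirstOrder

namespace Literature.ModelTheory.ExponentialFields

section Intervals

variable {M : Type*} [LinearOrder M]

/-- A subset `s` of a linear order `M` *is a finite union of intervals* if it belongs to the Boolean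
subalgebra of `Set M` generated by the open rays `Set.Iio a` and `Set.Ioi a` (`a : M`).
Equivalently, `s` is a finite union of points and open intervals whose endpoints lie in
`M ∪ {-∞, +∞}` (van den Dries 1998, Ch. 1, (1.4): the boolean algebra `B(A₁, …, Aₙ)` generated by
finitely many sets, and (3.2), (O2): "finite unions of intervals and points"; Pillay–Steinhorn 1986,
§1, p. 566: "a boolean combination of intervals is also a union of intervals"). [cite: Dries1998, Ch. 1 (3.2)] -/
def IsFiniteUnionOfIntervals (s : Set M) : Prop :=
  s ∈ BooleanSubalgebra.closure (Set.range (Set.Iio : M → Set M) ∪ Set.range (Set.Ioi : M → Set M))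

/-- Open left rays are finite unions of intervals (van den Dries 1998, Ch. 1, (3.2)). [cite: Dries1998, Ch. 1 (3.2)] -/
theorem isFiniteUnionOfIntervals_Iio (a : M) : IsFiniteUnionOfIntervals (Set.Iio a) :=
  BooleanSubalgebra.subset_closure (Or.inl ⟨a, rfl⟩)

/-- Open right rays are finite unions of intervals (van den Dries 1998, Ch. 1, (3.2)). [cite: Dries1998, Ch. 1 (3.2)] -/
theorem isFiniteUnionOfIntervals_Ioi (a : M) : IsFiniteUnionOfIntervals (Set.Ioi a) :=
  BooleanSubalgebra.subset_closure (Or.inr ⟨a, rfl⟩)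

/-- The empty set is a finite union of intervals (van den Dries 1998, Ch. 1, (3.2)). [cite: Dries1998, Ch. 1 (3.2)] -/
@[simp]
theorem isFiniteUnionOfIntervals_empty : IsFiniteUnionOfIntervals (∅ : Set M) :=
  BooleanSubalgebra.bot_mem

/-- The whole line is a finite union of intervals (van den Dries 1998, Ch. 1, (3.2)). [cite: Dries1998, Ch. 1 (3.2)] -/
@[simp]
theorem isFiniteUnionOfIntervals_univ : IsFiniteUnionOfIntervals (Set.univ : Set M) :=
  BooleanSubalgebra.top_mem

namespace IsFiniteUnionOfIntervals

variable {s t : Set M}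

/-- Finite unions of intervals are closed under binary union
(van den Dries 1998, Ch. 1, (3.2)). [cite: Dries1998, Ch. 1 (3.2)] -/
theorem union (hs : IsFiniteUnionOfIntervals s) (ht : IsFiniteUnionOfIntervals t) :
    IsFiniteUnionOfIntervals (s ∪ t) :=
  BooleanSubalgebra.sup_mem hs ht

/-- Finite unions of intervals are closed under binary intersection
(van den Dries 1998, Ch. 1, (3.2)). [cite: Dries1998, Ch. 1 (3.2)] -/
theorem inter (hs : IsFiniteUnionOfIntervals s) (ht : IsFiniteUnionOfIntervals t) :
    IsFiniteUnionOfIntervals (s ∩ t) :=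
  BooleanSubalgebra.inf_mem hs ht

/-- Finite unions of intervals are closed under complement
(van den Dries 1998, Ch. 1, (3.2)). [cite: Dries1998, Ch. 1 (3.2)] -/
theorem compl (hs : IsFiniteUnionOfIntervals s) : IsFiniteUnionOfIntervals sᶜ :=
  BooleanSubalgebra.compl_mem hs

/-- Finite unions of intervals are closed under set difference
(van den Dries 1998, Ch. 1, (3.2)). [cite: Dries1998, Ch. 1 (3.2)] -/
theorem diff (hs : IsFiniteUnionOfIntervals s) (ht : IsFiniteUnionOfIntervals t) :
    IsFiniteUnionOfIntervals (s \ t) :=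
  BooleanSubalgebra.sdiff_mem hs ht

end IsFiniteUnionOfIntervals

/-- Closed right rays `[a, ∞)` are finite unions of intervals
(van den Dries 1998, Ch. 1, (3.2)). [cite: Dries1998, Ch. 1 (3.2)] -/
theorem isFiniteUnionOfIntervals_Ici (a : M) : IsFiniteUnionOfIntervals (Set.Ici a) := by
  rw [← Set.compl_Iio]
  exact (isFiniteUnionOfIntervals_Iio a).compl

/-- Closed left rays `(-∞, a]` are finite unions of intervals
(van den Dries 1998, Ch. 1, (3.2)). [cite: Dries1998, Ch. 1 (3.2)] -/
theorem isFiniteUnionOfIntervals_Iic (a : M) : IsFiniteUnionOfIntervals (Set.Iic a) := by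
  rw [← Set.compl_Ioi]
  exact (isFiniteUnionOfIntervals_Ioi a).compl

/-- Open intervals are finite unions of intervals (van den Dries 1998, Ch. 1, (3.2)). [cite: Dries1998, Ch. 1 (3.2)] -/
theorem isFiniteUnionOfIntervals_Ioo (a b : M) : IsFiniteUnionOfIntervals (Set.Ioo a b) := by
  rw [← Set.Ioi_inter_Iio]
  exact (isFiniteUnionOfIntervals_Ioi a).inter (isFiniteUnionOfIntervals_Iio b)

/-- Closed intervals are finite unions of intervals (van den Dries 1998, Ch. 1, (3.2)). [cite: Dries1998, Ch. 1 (3.2)] -/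
theorem isFiniteUnionOfIntervals_Icc (a b : M) : IsFiniteUnionOfIntervals (Set.Icc a b) := by
  rw [← Set.Ici_inter_Iic]
  exact (isFiniteUnionOfIntervals_Ici a).inter (isFiniteUnionOfIntervals_Iic b)

/-- Points are finite unions of intervals (van den Dries 1998, Ch. 1, (3.2)). [cite: Dries1998, Ch. 1 (3.2)] -/
theorem isFiniteUnionOfIntervals_singleton (a : M) : IsFiniteUnionOfIntervals ({a} : Set M) := by
  rw [← Set.Icc_self]
  exact isFiniteUnionOfIntervals_Icc a a

/-- Finite sets are finite unions of intervals (van den Dries 1998, Ch. 1, (3.2)). [cite: Dries1998, Ch. 1 (3.2)] -/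
theorem IsFiniteUnionOfIntervals.of_finite {s : Set M} (hs : s.Finite) :
    IsFiniteUnionOfIntervals s := by
  induction s, hs using Set.Finite.induction_on with
  | empty => exact isFiniteUnionOfIntervals_empty
  | insert _ _ ih =>
    rw [Set.insert_eq]
    exact (isFiniteUnionOfIntervals_singleton _).union ih

end Intervals

end Literature.ModelTheory.ExponentialFields

namespace FirstOrder

namespace Language

variable {L : Language.{u, v}}

namespace Theory

/-- A theory `T` *has quantifier elimination* if every formula `φ` with free variables among
`x₀, …, xₙ₋₁` is `T`-equivalent to a quantifier-free formula `ψ` in the same variables, i.e.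
`T ⊨ ∀ x̄, φ(x̄) ↔ ψ(x̄)` (Marker, *Model Theory: An Introduction* (2002), Def. 3.1.1).
A definition (predicate on `T`, explicit binder), not a claim. [folklore] -/
def HasQE (T : L.Theory) : Prop :=
  ∀ (n : ℕ) (φ : L.Formula (Fin n)), ∃ ψ : L.Formula (Fin n), ψ.IsQF ∧ (φ ⇔[T] ψ)

/-- A theory `T` is *model complete* if every embedding `f : M ↪[L] N` between (nonempty) models of
`T` is elementary: for every formula `φ(x̄)` and tuple `ā` from `M`, `M ⊨ φ(ā) ↔ N ⊨ φ(f ā)`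
(Marker 2002, Def. 3.1.10 and Prop. 3.1.11; A. Robinson, *Complete theories* (1956)).
Models range over `Theory.ModelType.{u, v, max u v} T`, the universe convention of
`Theory.IsComplete`. A definition (predicate on `T`, explicit binder), not a claim. [cite: Marker2002, Def. 3.1.10 and Prop. 3.1.11] -/
def IsModelComplete (T : L.Theory) : Prop :=
  ∀ (M N : Theory.ModelType.{u, v, max u v} T) (f : M ↪[L] N) (n : ℕ) (φ : L.Formula (Fin n))
    (x : Fin n → M), φ.Realize (f ∘ x) ↔ φ.Realize x

variable {T : L.Theory}

/-- Unfolding lemma for `Theory.HasQE` (Marker 2002, Def. 3.1.1). [cite: Marker2002, Def. 3.1.1] -/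
theorem hasQE_iff : T.HasQE ↔
    ∀ (n : ℕ) (φ : L.Formula (Fin n)), ∃ ψ : L.Formula (Fin n), ψ.IsQF ∧ (φ ⇔[T] ψ) :=
  Iff.rfl

/-- A theory with quantifier elimination is model complete: quantifier-free formulas are preserved
and reflected by embeddings (Marker 2002, Prop. 3.1.11 with Cor. 3.1.6). [cite: Marker2002, Prop. 3.1.11 with Cor. 3.1.6] -/
def HasQE.isModelComplete : Prop :=
  ∀ (h : T.HasQE),
    T.IsModelComplete

/-- In a model complete theory, embeddings between models are elementary embeddings
(Marker 2002, Def. 3.1.10): the elementary embedding underlying `f`. [cite: Marker2002, Def. 3.1.10] -/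
def IsModelComplete.exists_elementaryEmbedding : Prop :=
  ∀ (h : T.IsModelComplete) (M N : Theory.ModelType.{u, v, max u v} T) (f : M ↪[L] N),
    ∃ g : M ↪ₑ[L] N, g.toEmbedding = f

/-- **Robinson's test** in syntactic form: a theory `T` is model complete if and only if every
formula is `T`-equivalent to an existential formula (Marker 2002, Prop. 3.1.12 / Ex. 3.4.11;
Chang–Keisler, *Model Theory*, Thm. 3.5.1). [cite: Marker2002, Prop. 3.1.12 / Ex. 3.4.11] -/
def isModelComplete_iff_forall_exists_isExistential : Prop :=
  T.IsModelComplete ↔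
    ∀ (n : ℕ) (φ : L.Formula (Fin n)),
      ∃ ψ : L.Formula (Fin n), ψ.IsExistential ∧ (φ ⇔[T] ψ)

/-- Completeness criterion from quantifier elimination: if `T` is satisfiable, has quantifier
elimination, and decides every quantifier-free sentence, then `T` is complete
(Marker 2002, proof of Cor. 3.1.7 / Cor. 3.3.16). [cite: Marker2002, proof of Cor. 3.1.7 / Cor. 3.3.16] -/
def HasQE.isComplete_of_qf_sentences_decided : Prop :=
  ∀ (h : T.HasQE) (hsat : T.IsSatisfiable) (hqf : ∀ φ : L.Sentence, BoundedFormula.IsQF φ → T ⊨ᵇ φ ∨ T ⊨ᵇ φ.not),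
    T.IsComplete

end Theory

section OMinimal

/-- An `L`-structure `M` carrying a linear order is *o-minimal* if every subset of `M` that is
definable with parameters from `M` is a finite union of points and open intervals with endpoints
in `M ∪ {±∞}` (Pillay–Steinhorn, *Definable sets in ordered structures I*, Trans. AMS 295 (1986),
Def. 1.1, p. 566: "a linearly ordered structure `M` is O-minimal if any parametrically definable
subset of `M` is a finite union of intervals in `M`", for an arbitrary linear order; van den Dries
1998, Ch. 1, (3.2) and (5.7) state the same for dense orders without endpoints; Marker 2002,
Def. 3.3.1). The intended use is with `[L.IsOrdered] [L.OrderedStructure M]`, so that `<` is itself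
definable, as in Pillay–Steinhorn's standing assumption that `L` contains `<`.

This is a *definition* — a predicate on the structure, with `L` and `M` as explicit binders — not
a claim: it fails e.g. for Presburger arithmetic `(ℤ; 0, 1, +)` (see `OMinimalExamples.lean`), and
holds for the real field and the real exponential field by the theorems of Tarski and Wilkie
(named facts in `RealExpField.lean`). [cite: PillaySteinhorn1986, Def. 1.1] -/
def IsOMinimal (L : Language.{u, v}) (M : Type w) [L.Structure M] [LinearOrder M] : Prop :=
  ∀ s : Set M, (Set.univ : Set M).Definable₁ L s → Literature.ModelTheory.ExponentialFields.IsFiniteUnionOfIntervals s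

variable {M : Type w} [L.Structure M] [LinearOrder M]

/-- Unfolding lemma for `Language.IsOMinimal` (Pillay–Steinhorn 1986, Def. 1.1). [cite: PillaySteinhorn1986, Def. 1.1] -/
theorem isOMinimal_iff : L.IsOMinimal M ↔
    ∀ s : Set M, (Set.univ : Set M).Definable₁ L s → Literature.ModelTheory.ExponentialFields.IsFiniteUnionOfIntervals s :=
  Iff.rfl

/-- In an o-minimal structure every parametrically definable subset of the line is a finite union
of points and intervals (Pillay–Steinhorn 1986, Def. 1.1). [cite: PillaySteinhorn1986, Def. 1.1] -/
theorem IsOMinimal.isFiniteUnionOfIntervals (h : L.IsOMinimal M) {s : Set M}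
    (hs : (Set.univ : Set M).Definable₁ L s) : Literature.ModelTheory.ExponentialFields.IsFiniteUnionOfIntervals s :=
  h s hs

/-- Sanity check: in an ordered structure (the symbol `≤` interpreted as the order), the converse
inclusion always holds — every finite union of intervals is definable with parameters. Hence
o-minimality says exactly that the definable subsets of `M` are the finite unions of intervals
(van den Dries 1998, Ch. 1, (3.2); Marker 2002, Def. 3.3.1). [cite: Dries1998, Ch. 1 (3.2)] -/
theorem definable₁_of_isFiniteUnionOfIntervals [L.IsOrdered] [L.OrderedStructure M] {s : Set M}
    (hs : Literature.ModelTheory.ExponentialFields.IsFiniteUnionOfIntervals s) : (Set.univ : Set M).Definable₁ L s := by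
  induction hs using BooleanSubalgebra.closure_bot_sup_induction with
  | mem s hs =>
    have hIio : ∀ a : M, (Set.univ : Set M).Definable₁ L (Set.Iio a) := fun a => by
      refine (Set.definable_iff_exists_formula_sum).2 ⟨Term.lt (Term.var (Sum.inl (Sum.inr 0)))
        (Term.var (Sum.inl (Sum.inl ⟨a, Set.mem_univ a⟩))), ?_⟩
      ext x
      simp [Formula.Realize]
    have hIoi : ∀ a : M, (Set.univ : Set M).Definable₁ L (Set.Ioi a) := fun a => by
      refine (Set.definable_iff_exists_formula_sum).2
        ⟨Term.lt (Term.var (Sum.inl (Sum.inl ⟨a, Set.mem_univ a⟩)))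
        (Term.var (Sum.inl (Sum.inr 0))), ?_⟩
      ext x
      simp [Formula.Realize]
    rcases hs with ⟨a, rfl⟩ | ⟨a, rfl⟩
    · exact hIio a
    · exact hIoi a
  | bot => exact Set.definable_empty
  | sup s _ t _ hs ht => exact Set.Definable.union hs ht
  | compl s _ hs => exact Set.Definable.compl hs

/-- Sanity check: in an ordered structure, o-minimality is equivalent to the statement that the
parametrically definable subsets of `M` are *exactly* the finite unions of points and intervals
(van den Dries 1998, Ch. 1, (3.2)). [cite: Dries1998, Ch. 1 (3.2)] -/
theorem isOMinimal_iff_definable₁_iff [L.IsOrdered] [L.OrderedStructure M] :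
    L.IsOMinimal M ↔
      ∀ s : Set M, (Set.univ : Set M).Definable₁ L s ↔ Literature.ModelTheory.ExponentialFields.IsFiniteUnionOfIntervals s :=
  ⟨fun h s => ⟨h s, definable₁_of_isFiniteUnionOfIntervals⟩, fun h s => (h s).1⟩

end OMinimal

namespace Theory

/-- A theory `T` in an ordered language is *o-minimal* if every model of `T`, with `≤` interpreted
as a linear order, is an o-minimal structure. This is the notion Pillay–Steinhorn, *Definable sets
in ordered structures I* (1986), Def. 1.1, p. 566 call a *strongly O-minimal* theory ("a
first-order theory `T` is strongly O-minimal if every model of `T` is O-minimal"); by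
Knight–Pillay–Steinhorn, *Definable sets in ordered structures II* (1986), o-minimality is
preserved under elementary equivalence, so the adjective "strongly" is nowadays dropped. The order
is supplied by explicit instance binders `[LinearOrder M] [L.OrderedStructure M]`; it is
determined by the `L`-structure. A definition (predicate on `T`, explicit binders), not a claim. [cite: PillaySteinhorn1986, Def. 1.1] -/
def IsOMinimal (T : L.Theory) [L.IsOrdered] : Prop :=
  ∀ (M : Theory.ModelType.{u, v, max u v} T) [LinearOrder M] [L.OrderedStructure M],
    L.IsOMinimal M

variable {T : L.Theory} [L.IsOrdered]

/-- Models of an o-minimal theory are o-minimal structures (Pillay–Steinhorn 1986). [cite: PillaySteinhorn1986] -/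
theorem IsOMinimal.isOMinimal_modelType (h : T.IsOMinimal)
    (M : Theory.ModelType.{u, v, max u v} T) [LinearOrder M] [L.OrderedStructure M] :
    L.IsOMinimal M :=
  h M

end Theory

end Language

end FirstOrder
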